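import Summits.CriticalPhenomena.PercolationContinuityZ3.Theorems.PercNearOneGluingNoHeavyLowerTailCubicFourPointL1Step
import Summits.CriticalPhenomena.PercolationContinuityZ3.Theorems.PercNearOneGluingNoHeavyLowerTailCubicThreePointGluingPendantCells
import Mathlib.Tactic.Ring
import Mathlib.Tactic.Linarith
import HarnessLib

/-!
# `NoHeavyLowerTail` (stmt-CriticalPhenomena-4575) — the polarised E3GRP form (L1) VANISHES on the cut-vertex face

Support file (prover prim-l12-p2, `--supports stmt-CriticalPhenomena-4575`; P2 = deletion–contraction induction).  No sorries, no named
facts, no new definitions: the events/masses of `…CubicFourPointL1Step` (`CubicFourPointL1.sep`, `cellA`, `massesW`, `l1W`) and the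
vertex-separator calculus of prim-sahi-p2 (`…CubicThreePointGluing`, `…GluingCells`, `…GluingPendantCells`: `cutVertex_iff`, `pendant_R_ab`,
`PrW_union_of_pointwise_mul(3)`).

THE FACE.  The census equality locus of (L1) `E1 + E2 ≥ β·P(b≁c)` (ttrl2 bern4 'POLARIZATION L1/L2': 1 176 exact equalities with RHS > 0,
ALL of the form "one hybrid row vanishes, the other equals β·P(b≁c)") is the CUT-VERTEX FACE: the terminal `b` separates `{a, y}` from `c`
(mirror: `c` separates `{a,y}` from `b`).  Here this is a THEOREM for every finite weighted graph:

SETTING (`section Face`).  Two pieces `(D₁,K₁)` (random / forced edges) and `(D₂,K₂)`, `D₁ ∩ D₂ = ∅`, whose edges meet only in the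
terminal `b` (`hsep`); `a, y` lie on no edge of piece 2 (`ha`, `hy`), `c` on no edge of piece 1 (`hc`); `a ≠ c`, `y ≠ c`, `b ≠ c`.
* pointwise (`face_R_bc_imp`/`face_iff_bc`, `face_R_ab`, `face_R_by`, and prim-sahi-p2's `pendant_R_ab` for `a~c ⟺ a~₁b ∧ b~₂c` and
  `y~c ⟺ y~₁b ∧ b~₂c`):  `b~c ⟺ b~₂c`, `a~b ⟺ a~₁b`, `b~y ⟺ b~₁y`;
* hence, pointwise, each of the 14 events of (L1) is a product (or a sum of two products) of a piece-1 and a piece-2 event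
  (`ind_face_bc`, …, `ind_face_bc_gc_ab`), and by independence of the pieces (`PrW_union_of_pointwise_mul`) the 14 masses FACTOR
  through `z̄ = P₂(b≁c)`, `z = P₂(b~c) = 1 − z̄`, `m₁ = P₁(a≁b)`, `m₂ = P₁(a≁b, b≁y)`, `m₃ = P₁(a≁b, b~y) = m₁ − m₂`, `m̄₁ = P₁(a~b) = 1 − m₁`
  (e.g. `P(a≁c) = m₁ + m̄₁ z̄`, `P(c≁a,c≁y) = z̄ + m₂ z`, `β = m₃ z`);
* **`l1W_cutFace_eq_zero`**: `L1 = 0` on the face, for every weight vector (after the factorisation it is a `ring` identity; in it the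
  first hybrid row `E1 = E3(D_bc,D_ac,G_ab)` vanishes identically and `E2 = E3(D_bc,G_ac,D_ab) = z z̄ m₃ = β·P(b≁c)`).
So any certificate / induction for (L1) must be tight on this face (cf. harness-2: no polynomial certificate of degree ≤ 6 exists; the
vanishing is NOT an identity on the zero-cell subspace but uses the product structure across the separator, formalised here).
[cite: Grimmett1999, §2.2 (product measure: independence of disjoint edge sets)]; [cite: GladkovZimin2024HK, §4 (block decomposition)]
-/

noncomputable section

namespace Summit.CriticalPhenomena.PercolationContinuityZ3.Theorems

namespace CubicFourPointL1

open Finset SimpleGraph Literature.Probability.Percolation.DecisionTree CubicThreePointStep TerminalGluing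

variable {V : Type*} [DecidableEq V]

/-! ### Indicator bookkeeping -/

/-- An event that is pointwise a product of a piece-1 and a piece-2 event. [folklore] -/
theorem ind_eq_mul_of_iff {α β γ : Type*} {X : Set α} {A : Set β} {B : Set γ} {s : α} {u : β} {w : γ}
    (h : s ∈ X ↔ u ∈ A ∧ w ∈ B) : ind X s = ind A u * ind B w := by
  by_cases hu : u ∈ A <;> by_cases hw : w ∈ B
  · rw [ind_of_mem (h.2 ⟨hu, hw⟩), ind_of_mem hu, ind_of_mem hw, mul_one]
  · rw [ind_of_not_mem (fun hs => hw (h.1 hs).2), ind_of_not_mem hw, mul_zero]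
  · rw [ind_of_not_mem (fun hs => hu (h.1 hs).1), ind_of_not_mem hu, zero_mul]
  · rw [ind_of_not_mem (fun hs => hu (h.1 hs).1), ind_of_not_mem hu, zero_mul]

/-- An event that is pointwise a sum of two products, the piece-2 factors being disjoint. [folklore] -/
theorem ind_eq_mul_add_mul_of_iff {α β γ : Type*} {X : Set α} {A A' : Set β} {B B' : Set γ} {s : α} {u : β} {w : γ}
    (h : s ∈ X ↔ (u ∈ A ∧ w ∈ B) ∨ (u ∈ A' ∧ w ∈ B')) (hB : ¬ (w ∈ B ∧ w ∈ B')) :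
    ind X s = ind A u * ind B w + ind A' u * ind B' w + ind (∅ : Set β) u * ind (∅ : Set γ) w := by
  rw [ind_of_not_mem (Set.notMem_empty u), zero_mul, add_zero]
  by_cases hw : w ∈ B
  · have hw' : w ∉ B' := fun h' => hB ⟨hw, h'⟩
    rw [ind_of_mem hw, ind_of_not_mem hw', mul_one, mul_zero, add_zero]
    by_cases hu : u ∈ A
    · rw [ind_of_mem hu, ind_of_mem (h.2 (Or.inl ⟨hu, hw⟩))]
    · rw [ind_of_not_mem hu]
      exact ind_of_not_mem fun hs => (h.1 hs).elim (fun h1 => hu h1.1) fun h2 => hw' h2.2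
  · rw [ind_of_not_mem hw, mul_zero, zero_add]
    by_cases hw' : w ∈ B'
    · rw [ind_of_mem hw', mul_one]
      by_cases hu : u ∈ A'
      · rw [ind_of_mem hu, ind_of_mem (h.2 (Or.inr ⟨hu, hw'⟩))]
      · rw [ind_of_not_mem hu]
        exact ind_of_not_mem fun hs => (h.1 hs).elim (fun h1 => hw h1.2) fun h2 => hu h2.1
    · rw [ind_of_not_mem hw', mul_zero]
      exact ind_of_not_mem fun hs => (h.1 hs).elim (fun h1 => hw h1.2) fun h2 => hw' h2.2

/-! ### The face: pointwise decomposition of the five connection atoms across the separator `b` -/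

section Face

variable {D₁ D₂ K₁ K₂ : Finset (Sym2 V)} {a b c y : V}
  (hsep : ∀ v : V, ∀ e₁ ∈ D₁ ∪ K₁, ∀ e₂ ∈ D₂ ∪ K₂, v ∈ e₁ → v ∈ e₂ → v = b)
  (ha : ∀ e ∈ D₂ ∪ K₂, a ∉ e) (hy : ∀ e ∈ D₂ ∪ K₂, y ∉ e) (hc : ∀ e ∈ D₁ ∪ K₁, c ∉ e)
  (hac : a ≠ c) (hyc : y ≠ c) (hbc : b ≠ c)
  {S₁ S₂ : Finset (Sym2 V)} (hS₁ : S₁ ⊆ D₁) (hS₂ : S₂ ⊆ D₂)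

section Pointwise
include hsep hS₁ hS₂

section
include hc hbc
/-- On the face, a connection `b ~ c` of the glued configuration lies inside piece 2 (the converse is `R_union_of_right`). [folklore] -/
theorem face_R_bc_imp (h : R (K₁ ∪ K₂) (S₁ ∪ S₂) b c) : R K₂ S₂ b c := by
  rw [R_union_iff, cutVertex_iff (pendant_hT hsep hS₁ hS₂)] at h
  have h1 : ¬ (fromEdgeSet (↑(S₁ ∪ K₁) : Set (Sym2 V))).Reachable b c := fun h =>
    hbc (TerminalGluing.eq_of_reachable_of_isolated (not_adj_of_avoids hS₁ hc) h.symm).symm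
  rcases h with (h | h) | ⟨_, h | h⟩ <;> first | exact absurd h h1 | exact h

/-- On the face, `b ~ c` in the glued configuration is `b ~ c` inside piece 2 (as an equation of propositions, for `simp`/`rw`). [folklore] -/
theorem face_iff_bc : (R (K₁ ∪ K₂) (S₁ ∪ S₂) b c) = (R K₂ S₂ b c) :=
  propext ⟨face_R_bc_imp hsep hc hbc hS₁ hS₂, R_union_of_right⟩
end

section
include ha
/-- On the face, `a ~ b` iff `a ~ b` inside piece 1. [folklore] -/
theorem face_R_ab : R (K₁ ∪ K₂) (S₁ ∪ S₂) a b ↔ R K₁ S₁ a b := by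
  rw [R_union_iff, cutVertex_iff (pendant_hT hsep hS₁ hS₂)]
  have h2 : (fromEdgeSet (↑(S₂ ∪ K₂) : Set (Sym2 V))).Reachable a b →
      (fromEdgeSet (↑(S₁ ∪ K₁) : Set (Sym2 V))).Reachable a b := fun h => by
    obtain hab := TerminalGluing.eq_of_reachable_of_isolated (not_adj_of_avoids hS₂ ha) h
    subst hab
    exact Reachable.refl _
  exact ⟨by rintro ((h | h) | ⟨h | h, _⟩) <;> first | exact h | exact h2 h, fun h => Or.inl (Or.inl h)⟩
end

section
include hy
/-- On the face, `b ~ y` iff `b ~ y` inside piece 1. [folklore] -/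
theorem face_R_by : R (K₁ ∪ K₂) (S₁ ∪ S₂) b y ↔ R K₁ S₁ b y := by
  rw [R_union_iff, cutVertex_iff (pendant_hT hsep hS₁ hS₂)]
  have h2 : (fromEdgeSet (↑(S₂ ∪ K₂) : Set (Sym2 V))).Reachable b y →
      (fromEdgeSet (↑(S₁ ∪ K₁) : Set (Sym2 V))).Reachable b y := fun h => by
    obtain hyb := TerminalGluing.eq_of_reachable_of_isolated (not_adj_of_avoids hS₂ hy) h.symm
    subst hyb
    exact Reachable.refl _
  exact ⟨by rintro ((h | h) | ⟨_, h | h⟩) <;> first | exact h | exact h2 h, fun h => Or.inl (Or.inl h)⟩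
end

include ha hy hc hac hyc hbc

omit ha hy hac hyc in
/-- `1[b≁c] = 1 · 1₂[b≁c]`. [folklore] -/
theorem ind_face_bc : ind (sep (K₁ ∪ K₂) b c) (S₁ ∪ S₂) = ind (Set.univ : Set (Finset (Sym2 V))) S₁ * ind (sep K₂ b c) S₂ :=
  ind_eq_mul_of_iff (by
    simp only [mem_sep, Set.mem_univ, true_and, face_iff_bc hsep hc hbc hS₁ hS₂])

omit hy hyc hbc in
/-- `1[a≁c] = 1₁[a≁b]·1 + 1₁[a~b]·1₂[b≁c]`. [folklore] -/
theorem ind_face_ac : ind (sep (K₁ ∪ K₂) a c) (S₁ ∪ S₂) =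
    ind (sep K₁ a b) S₁ * ind (Set.univ : Set (Finset (Sym2 V))) S₂ + ind {S | R K₁ S a b} S₁ * ind (sep K₂ b c) S₂
      + ind (∅ : Set (Finset (Sym2 V))) S₁ * ind (∅ : Set (Finset (Sym2 V))) S₂ := by
  by_cases h1 : R K₁ S₁ a b <;> by_cases h2 : R K₂ S₂ b c
  · rw [ind_of_not_mem (show S₁ ∪ S₂ ∉ sep (K₁ ∪ K₂) a c from fun h =>
        (mem_sep _ _ _ _).1 h ((pendant_R_ab hsep ha hc hac hS₁ hS₂).2 ⟨h1, h2⟩)),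
      ind_of_not_mem (show S₁ ∉ sep K₁ a b from fun h => (mem_sep _ _ _ _).1 h h1),
      ind_of_not_mem (show S₂ ∉ sep K₂ b c from fun h => (mem_sep _ _ _ _).1 h h2),
      ind_of_not_mem (Set.notMem_empty S₁)]
    ring
  · rw [ind_of_mem (show S₁ ∪ S₂ ∈ sep (K₁ ∪ K₂) a c from fun h => h2 ((pendant_R_ab hsep ha hc hac hS₁ hS₂).1 h).2),
      ind_of_not_mem (show S₁ ∉ sep K₁ a b from fun h => (mem_sep _ _ _ _).1 h h1),
      ind_of_mem (show S₁ ∈ {S | R K₁ S a b} from h1), ind_of_mem (show S₂ ∈ sep K₂ b c from h2),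
      ind_of_not_mem (Set.notMem_empty S₁)]
    ring
  · rw [ind_of_mem (show S₁ ∪ S₂ ∈ sep (K₁ ∪ K₂) a c from fun h => h1 ((pendant_R_ab hsep ha hc hac hS₁ hS₂).1 h).1),
      ind_of_mem (show S₁ ∈ sep K₁ a b from h1), ind_of_mem (Set.mem_univ S₂),
      ind_of_not_mem (show S₁ ∉ {S | R K₁ S a b} from h1), ind_of_not_mem (Set.notMem_empty S₁)]
    ring
  · rw [ind_of_mem (show S₁ ∪ S₂ ∈ sep (K₁ ∪ K₂) a c from fun h => h1 ((pendant_R_ab hsep ha hc hac hS₁ hS₂).1 h).1),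
      ind_of_mem (show S₁ ∈ sep K₁ a b from h1), ind_of_mem (Set.mem_univ S₂),
      ind_of_not_mem (show S₁ ∉ {S | R K₁ S a b} from h1), ind_of_not_mem (Set.notMem_empty S₁)]
    ring

omit hy hc hac hyc hbc in
/-- `1[a≁b] = 1₁[a≁b] · 1`. [folklore] -/
theorem ind_face_ab : ind (sep (K₁ ∪ K₂) a b) (S₁ ∪ S₂) = ind (sep K₁ a b) S₁ * ind (Set.univ : Set (Finset (Sym2 V))) S₂ :=
  ind_eq_mul_of_iff (by
    simp only [mem_sep, Set.mem_univ, and_true, face_R_ab hsep ha hS₁ hS₂])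

omit hc hac hyc hbc in
/-- `1[a≁b, b≁y] = 1₁[a≁b, b≁y] · 1`. [folklore] -/
theorem ind_face_gb : ind (sep (K₁ ∪ K₂) a b ∩ sep (K₁ ∪ K₂) b y) (S₁ ∪ S₂) =
    ind (sep K₁ a b ∩ sep K₁ b y) S₁ * ind (Set.univ : Set (Finset (Sym2 V))) S₂ :=
  ind_eq_mul_of_iff (by
    simp only [Set.mem_inter_iff, mem_sep, Set.mem_univ, and_true, face_R_ab hsep ha hS₁ hS₂,
      face_R_by hsep hy hS₁ hS₂])

omit hbc in
/-- `1[c≁a, c≁y] = 1·1₂[b≁c] + 1₁[a≁b, b≁y]·1₂[b~c]`. [folklore] -/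
theorem ind_face_gc : ind (sep (K₁ ∪ K₂) a c ∩ sep (K₁ ∪ K₂) c y) (S₁ ∪ S₂) =
    ind (Set.univ : Set (Finset (Sym2 V))) S₁ * ind (sep K₂ b c) S₂
      + ind (sep K₁ a b ∩ sep K₁ b y) S₁ * ind {S | R K₂ S b c} S₂
      + ind (∅ : Set (Finset (Sym2 V))) S₁ * ind (∅ : Set (Finset (Sym2 V))) S₂ := by
  refine ind_eq_mul_add_mul_of_iff ?_ (fun h => (mem_sep _ _ _ _).1 h.1 h.2)
  simp only [Set.mem_inter_iff, mem_sep, Set.mem_univ, true_and, Set.mem_setOf_eq, pendant_R_ab hsep ha hc hac hS₁ hS₂]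
  have eyc : R (K₁ ∪ K₂) (S₁ ∪ S₂) c y ↔ R K₁ S₁ y b ∧ R K₂ S₂ b c :=
    ⟨fun h => (pendant_R_ab hsep hy hc hyc hS₁ hS₂).1 h.symm, fun h => ((pendant_R_ab hsep hy hc hyc hS₁ hS₂).2 h).symm⟩
  rw [eyc]
  have eby : R K₁ S₁ y b ↔ R K₁ S₁ b y := ⟨fun h => h.symm, fun h => h.symm⟩
  rw [eby]
  tauto

omit hac hyc in
/-- `1[a|bcy] = 1₁[a≁b, b~y] · 1₂[b~c]`. [folklore] -/
theorem ind_face_beta : ind (cellA (K₁ ∪ K₂) a b c y) (S₁ ∪ S₂) =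
    ind {S | ¬ R K₁ S a b ∧ R K₁ S b y} S₁ * ind {S | R K₂ S b c} S₂ :=
  ind_eq_mul_of_iff (by
    simp only [mem_cellA, Set.mem_setOf_eq, face_R_ab hsep ha hS₁ hS₂, face_iff_bc hsep hc hbc hS₁ hS₂,
      face_R_by hsep hy hS₁ hS₂]
    tauto)

omit hy hyc in
/-- `1[b≁c, a≁c] = 1 · 1₂[b≁c]`. [folklore] -/
theorem ind_face_bc_ac : ind (sep (K₁ ∪ K₂) b c ∩ sep (K₁ ∪ K₂) a c) (S₁ ∪ S₂) =
    ind (Set.univ : Set (Finset (Sym2 V))) S₁ * ind (sep K₂ b c) S₂ :=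
  ind_eq_mul_of_iff (by
    simp only [Set.mem_inter_iff, mem_sep, Set.mem_univ, true_and, face_iff_bc hsep hc hbc hS₁ hS₂,
      pendant_R_ab hsep ha hc hac hS₁ hS₂]
    tauto)

omit hac hyc in
/-- `1[b≁c, a≁b, b≁y] = 1₁[a≁b, b≁y] · 1₂[b≁c]`. [folklore] -/
theorem ind_face_bc_gb : ind (sep (K₁ ∪ K₂) b c ∩ (sep (K₁ ∪ K₂) a b ∩ sep (K₁ ∪ K₂) b y)) (S₁ ∪ S₂) =
    ind (sep K₁ a b ∩ sep K₁ b y) S₁ * ind (sep K₂ b c) S₂ :=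
  ind_eq_mul_of_iff (by
    simp only [Set.mem_inter_iff, mem_sep, face_iff_bc hsep hc hbc hS₁ hS₂, face_R_ab hsep ha hS₁ hS₂,
      face_R_by hsep hy hS₁ hS₂]
    tauto)

omit hyc hbc in
/-- `1[a≁c, a≁b, b≁y] = 1₁[a≁b, b≁y] · 1`. [folklore] -/
theorem ind_face_ac_gb : ind (sep (K₁ ∪ K₂) a c ∩ (sep (K₁ ∪ K₂) a b ∩ sep (K₁ ∪ K₂) b y)) (S₁ ∪ S₂) =
    ind (sep K₁ a b ∩ sep K₁ b y) S₁ * ind (Set.univ : Set (Finset (Sym2 V))) S₂ :=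
  ind_eq_mul_of_iff (by
    simp only [Set.mem_inter_iff, mem_sep, Set.mem_univ, and_true, pendant_R_ab hsep ha hc hac hS₁ hS₂,
      face_R_ab hsep ha hS₁ hS₂, face_R_by hsep hy hS₁ hS₂]
    tauto)

omit hyc in
/-- `1[b≁c, a≁c, a≁b, b≁y] = 1₁[a≁b, b≁y] · 1₂[b≁c]`. [folklore] -/
theorem ind_face_bc_ac_gb :
    ind ((sep (K₁ ∪ K₂) b c ∩ sep (K₁ ∪ K₂) a c) ∩ (sep (K₁ ∪ K₂) a b ∩ sep (K₁ ∪ K₂) b y)) (S₁ ∪ S₂) =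
    ind (sep K₁ a b ∩ sep K₁ b y) S₁ * ind (sep K₂ b c) S₂ :=
  ind_eq_mul_of_iff (by
    simp only [Set.mem_inter_iff, mem_sep, face_iff_bc hsep hc hbc hS₁ hS₂, pendant_R_ab hsep ha hc hac hS₁ hS₂,
      face_R_ab hsep ha hS₁ hS₂, face_R_by hsep hy hS₁ hS₂]
    tauto)

/-- `1[b≁c, c≁a, c≁y] = 1 · 1₂[b≁c]`. [folklore] -/
theorem ind_face_bc_gc : ind (sep (K₁ ∪ K₂) b c ∩ (sep (K₁ ∪ K₂) a c ∩ sep (K₁ ∪ K₂) c y)) (S₁ ∪ S₂) =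
    ind (Set.univ : Set (Finset (Sym2 V))) S₁ * ind (sep K₂ b c) S₂ :=
  ind_eq_mul_of_iff (by
    simp only [Set.mem_inter_iff, mem_sep, Set.mem_univ, true_and, face_iff_bc hsep hc hbc hS₁ hS₂,
      pendant_R_ab hsep ha hc hac hS₁ hS₂]
    have eyc : R (K₁ ∪ K₂) (S₁ ∪ S₂) c y ↔ R K₁ S₁ y b ∧ R K₂ S₂ b c :=
      ⟨fun h => (pendant_R_ab hsep hy hc hyc hS₁ hS₂).1 h.symm, fun h => ((pendant_R_ab hsep hy hc hyc hS₁ hS₂).2 h).symm⟩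
    rw [eyc]
    tauto)

omit hy hac hyc in
/-- `1[b≁c, a≁b] = 1₁[a≁b] · 1₂[b≁c]`. [folklore] -/
theorem ind_face_bc_ab : ind (sep (K₁ ∪ K₂) b c ∩ sep (K₁ ∪ K₂) a b) (S₁ ∪ S₂) =
    ind (sep K₁ a b) S₁ * ind (sep K₂ b c) S₂ :=
  ind_eq_mul_of_iff (by
    simp only [Set.mem_inter_iff, mem_sep, face_iff_bc hsep hc hbc hS₁ hS₂, face_R_ab hsep ha hS₁ hS₂]
    tauto)

omit hbc in
/-- `1[c≁a, c≁y, a≁b] = 1₁[a≁b]·1₂[b≁c] + 1₁[a≁b, b≁y]·1₂[b~c]`. [folklore] -/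
theorem ind_face_gc_ab : ind ((sep (K₁ ∪ K₂) a c ∩ sep (K₁ ∪ K₂) c y) ∩ sep (K₁ ∪ K₂) a b) (S₁ ∪ S₂) =
    ind (sep K₁ a b) S₁ * ind (sep K₂ b c) S₂
      + ind (sep K₁ a b ∩ sep K₁ b y) S₁ * ind {S | R K₂ S b c} S₂
      + ind (∅ : Set (Finset (Sym2 V))) S₁ * ind (∅ : Set (Finset (Sym2 V))) S₂ := by
  refine ind_eq_mul_add_mul_of_iff ?_ (fun h => (mem_sep _ _ _ _).1 h.1 h.2)
  simp only [Set.mem_inter_iff, mem_sep, Set.mem_setOf_eq, pendant_R_ab hsep ha hc hac hS₁ hS₂,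
    face_R_ab hsep ha hS₁ hS₂]
  have eyc : R (K₁ ∪ K₂) (S₁ ∪ S₂) c y ↔ R K₁ S₁ y b ∧ R K₂ S₂ b c :=
    ⟨fun h => (pendant_R_ab hsep hy hc hyc hS₁ hS₂).1 h.symm, fun h => ((pendant_R_ab hsep hy hc hyc hS₁ hS₂).2 h).symm⟩
  rw [eyc]
  have eby : R K₁ S₁ y b ↔ R K₁ S₁ b y := ⟨fun h => h.symm, fun h => h.symm⟩
  rw [eby]
  tauto

/-- `1[b≁c, c≁a, c≁y, a≁b] = 1₁[a≁b] · 1₂[b≁c]`. [folklore] -/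
theorem ind_face_bc_gc_ab :
    ind ((sep (K₁ ∪ K₂) b c ∩ (sep (K₁ ∪ K₂) a c ∩ sep (K₁ ∪ K₂) c y)) ∩ sep (K₁ ∪ K₂) a b) (S₁ ∪ S₂) =
    ind (sep K₁ a b) S₁ * ind (sep K₂ b c) S₂ :=
  ind_eq_mul_of_iff (by
    simp only [Set.mem_inter_iff, mem_sep, face_iff_bc hsep hc hbc hS₁ hS₂, pendant_R_ab hsep ha hc hac hS₁ hS₂,
      face_R_ab hsep ha hS₁ hS₂]
    have eyc : R (K₁ ∪ K₂) (S₁ ∪ S₂) c y ↔ R K₁ S₁ y b ∧ R K₂ S₂ b c :=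
      ⟨fun h => (pendant_R_ab hsep hy hc hyc hS₁ hS₂).1 h.symm, fun h => ((pendant_R_ab hsep hy hc hyc hS₁ hS₂).2 h).symm⟩
    rw [eyc]
    tauto)

end Pointwise

/-! ### The face: summing over the glued cube, and `L1 = 0` -/

variable (p : Sym2 V → ℝ) (hD : Disjoint D₁ D₂)
include hD hsep ha hy hc hac hyc hbc

/-- **(L1) vanishes on the cut-vertex face.**  If the terminal `b` separates `{a, y}` from `c` (pieces `(D₁,K₁) ∋ a,y,b` and
`(D₂,K₂) ∋ b,c` meeting only in `b`), then `E1 + E2 − β·P(b≁c) = 0` for every weight vector. [folklore] -/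
theorem l1W_cutFace_eq_zero : l1W (D₁ ∪ D₂) p (K₁ ∪ K₂) a b c y = 0 := by
  -- the six piece masses and their two linear relations
  have hu1 : PrW D₁ p (Set.univ : Set (Finset (Sym2 V))) = 1 := PrW_univ _ p
  have hu2 : PrW D₂ p (Set.univ : Set (Finset (Sym2 V))) = 1 := PrW_univ _ p
  have he1 : PrW D₁ p (∅ : Set (Finset (Sym2 V))) = 0 := PrW_eq_zero_of_forall D₁ p fun S _ => Set.notMem_empty S
  have hz : PrW D₂ p {S | R K₂ S b c} = 1 - PrW D₂ p (sep K₂ b c) := by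
    have : PrW D₂ p (Set.univ : Set (Finset (Sym2 V))) = PrW D₂ p {S | R K₂ S b c} + PrW D₂ p (sep K₂ b c) := by
      refine PrW_of_ind_add D₂ p fun S _ => ?_
      by_cases h : R K₂ S b c
      · rw [ind_of_mem (Set.mem_univ S), ind_of_mem (show S ∈ {S | R K₂ S b c} from h),
          ind_of_not_mem (show S ∉ sep K₂ b c from fun h' => (mem_sep _ _ _ _).1 h' h), add_zero]
      · rw [ind_of_mem (Set.mem_univ S), ind_of_not_mem (show S ∉ {S | R K₂ S b c} from h),
          ind_of_mem (show S ∈ sep K₂ b c from h), zero_add]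
    rw [hu2] at this; linarith
  have hmb : PrW D₁ p {S | R K₁ S a b} = 1 - PrW D₁ p (sep K₁ a b) := by
    have : PrW D₁ p (Set.univ : Set (Finset (Sym2 V))) = PrW D₁ p {S | R K₁ S a b} + PrW D₁ p (sep K₁ a b) := by
      refine PrW_of_ind_add D₁ p fun S _ => ?_
      by_cases h : R K₁ S a b
      · rw [ind_of_mem (Set.mem_univ S), ind_of_mem (show S ∈ {S | R K₁ S a b} from h),
          ind_of_not_mem (show S ∉ sep K₁ a b from fun h' => (mem_sep _ _ _ _).1 h' h), add_zero]
      · rw [ind_of_mem (Set.mem_univ S), ind_of_not_mem (show S ∉ {S | R K₁ S a b} from h),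
          ind_of_mem (show S ∈ sep K₁ a b from h), zero_add]
    rw [hu1] at this; linarith
  have hm3 : PrW D₁ p {S | ¬ R K₁ S a b ∧ R K₁ S b y} = PrW D₁ p (sep K₁ a b) - PrW D₁ p (sep K₁ a b ∩ sep K₁ b y) := by
    have : PrW D₁ p (sep K₁ a b) = PrW D₁ p (sep K₁ a b ∩ sep K₁ b y) + PrW D₁ p {S | ¬ R K₁ S a b ∧ R K₁ S b y} := by
      refine PrW_of_ind_add D₁ p fun S _ => ?_
      by_cases h1 : R K₁ S a b
      · rw [ind_of_not_mem (show S ∉ sep K₁ a b from fun h' => (mem_sep _ _ _ _).1 h' h1),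
          ind_of_not_mem (show S ∉ sep K₁ a b ∩ sep K₁ b y from fun h' => (mem_sep _ _ _ _).1 h'.1 h1),
          ind_of_not_mem (show S ∉ {S | ¬ R K₁ S a b ∧ R K₁ S b y} from fun h' => h'.1 h1), add_zero]
      · by_cases h2 : R K₁ S b y
        · rw [ind_of_mem (show S ∈ sep K₁ a b from h1),
            ind_of_not_mem (show S ∉ sep K₁ a b ∩ sep K₁ b y from fun h' => (mem_sep _ _ _ _).1 h'.2 h2),
            ind_of_mem (show S ∈ {S | ¬ R K₁ S a b ∧ R K₁ S b y} from ⟨h1, h2⟩), zero_add]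
        · rw [ind_of_mem (show S ∈ sep K₁ a b from h1),
            ind_of_mem (show S ∈ sep K₁ a b ∩ sep K₁ b y from ⟨h1, h2⟩),
            ind_of_not_mem (show S ∉ {S | ¬ R K₁ S a b ∧ R K₁ S b y} from fun h' => h2 h'.2), add_zero]
    linarith
  -- the fourteen factorised masses
  have f1 : PrW (D₁ ∪ D₂) p (sep (K₁ ∪ K₂) b c) = 1 * PrW D₂ p (sep K₂ b c) := by
    rw [← hu1]; exact PrW_union_of_pointwise_mul p hD fun _ _ hS₁ hS₂ => ind_face_bc hsep hc hbc hS₁ hS₂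
  have f2 : PrW (D₁ ∪ D₂) p (sep (K₁ ∪ K₂) a c) =
      PrW D₁ p (sep K₁ a b) * 1 + PrW D₁ p {S | R K₁ S a b} * PrW D₂ p (sep K₂ b c) + PrW D₁ p ∅ * PrW D₂ p ∅ := by
    rw [← hu2]
    exact PrW_union_of_pointwise_mul3 p hD fun _ _ hS₁ hS₂ => ind_face_ac hsep ha hc hac hS₁ hS₂
  have f3 : PrW (D₁ ∪ D₂) p (sep (K₁ ∪ K₂) a b) = PrW D₁ p (sep K₁ a b) * 1 := by
    rw [← hu2]; exact PrW_union_of_pointwise_mul p hD fun _ _ hS₁ hS₂ => ind_face_ab hsep ha hS₁ hS₂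
  have f4 : PrW (D₁ ∪ D₂) p (sep (K₁ ∪ K₂) a b ∩ sep (K₁ ∪ K₂) b y) = PrW D₁ p (sep K₁ a b ∩ sep K₁ b y) * 1 := by
    rw [← hu2]; exact PrW_union_of_pointwise_mul p hD fun _ _ hS₁ hS₂ => ind_face_gb hsep ha hy hS₁ hS₂
  have f5 : PrW (D₁ ∪ D₂) p (sep (K₁ ∪ K₂) a c ∩ sep (K₁ ∪ K₂) c y) =
      1 * PrW D₂ p (sep K₂ b c) + PrW D₁ p (sep K₁ a b ∩ sep K₁ b y) * PrW D₂ p {S | R K₂ S b c}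
        + PrW D₁ p ∅ * PrW D₂ p ∅ := by
    rw [← hu1]
    exact PrW_union_of_pointwise_mul3 p hD fun _ _ hS₁ hS₂ => ind_face_gc hsep ha hy hc hac hyc hS₁ hS₂
  have f6 : PrW (D₁ ∪ D₂) p (cellA (K₁ ∪ K₂) a b c y) =
      PrW D₁ p {S | ¬ R K₁ S a b ∧ R K₁ S b y} * PrW D₂ p {S | R K₂ S b c} :=
    PrW_union_of_pointwise_mul p hD fun _ _ hS₁ hS₂ => ind_face_beta hsep ha hy hc hbc hS₁ hS₂
  have f7 : PrW (D₁ ∪ D₂) p (sep (K₁ ∪ K₂) b c ∩ sep (K₁ ∪ K₂) a c) = 1 * PrW D₂ p (sep K₂ b c) := by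
    rw [← hu1]; exact PrW_union_of_pointwise_mul p hD fun _ _ hS₁ hS₂ => ind_face_bc_ac hsep ha hc hac hbc hS₁ hS₂
  have f8 : PrW (D₁ ∪ D₂) p (sep (K₁ ∪ K₂) b c ∩ (sep (K₁ ∪ K₂) a b ∩ sep (K₁ ∪ K₂) b y)) =
      PrW D₁ p (sep K₁ a b ∩ sep K₁ b y) * PrW D₂ p (sep K₂ b c) :=
    PrW_union_of_pointwise_mul p hD fun _ _ hS₁ hS₂ => ind_face_bc_gb hsep ha hy hc hbc hS₁ hS₂
  have f9 : PrW (D₁ ∪ D₂) p (sep (K₁ ∪ K₂) a c ∩ (sep (K₁ ∪ K₂) a b ∩ sep (K₁ ∪ K₂) b y)) =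
      PrW D₁ p (sep K₁ a b ∩ sep K₁ b y) * 1 := by
    rw [← hu2]; exact PrW_union_of_pointwise_mul p hD fun _ _ hS₁ hS₂ => ind_face_ac_gb hsep ha hy hc hac hS₁ hS₂
  have f10 : PrW (D₁ ∪ D₂) p ((sep (K₁ ∪ K₂) b c ∩ sep (K₁ ∪ K₂) a c) ∩ (sep (K₁ ∪ K₂) a b ∩ sep (K₁ ∪ K₂) b y)) =
      PrW D₁ p (sep K₁ a b ∩ sep K₁ b y) * PrW D₂ p (sep K₂ b c) :=
    PrW_union_of_pointwise_mul p hD fun _ _ hS₁ hS₂ => ind_face_bc_ac_gb hsep ha hy hc hac hbc hS₁ hS₂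
  have f11 : PrW (D₁ ∪ D₂) p (sep (K₁ ∪ K₂) b c ∩ (sep (K₁ ∪ K₂) a c ∩ sep (K₁ ∪ K₂) c y)) = 1 * PrW D₂ p (sep K₂ b c) := by
    rw [← hu1]; exact PrW_union_of_pointwise_mul p hD fun _ _ hS₁ hS₂ => ind_face_bc_gc hsep ha hy hc hac hyc hbc hS₁ hS₂
  have f12 : PrW (D₁ ∪ D₂) p (sep (K₁ ∪ K₂) b c ∩ sep (K₁ ∪ K₂) a b) = PrW D₁ p (sep K₁ a b) * PrW D₂ p (sep K₂ b c) :=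
    PrW_union_of_pointwise_mul p hD fun _ _ hS₁ hS₂ => ind_face_bc_ab hsep ha hc hbc hS₁ hS₂
  have f13 : PrW (D₁ ∪ D₂) p ((sep (K₁ ∪ K₂) a c ∩ sep (K₁ ∪ K₂) c y) ∩ sep (K₁ ∪ K₂) a b) =
      PrW D₁ p (sep K₁ a b) * PrW D₂ p (sep K₂ b c) + PrW D₁ p (sep K₁ a b ∩ sep K₁ b y) * PrW D₂ p {S | R K₂ S b c}
        + PrW D₁ p ∅ * PrW D₂ p ∅ :=
    PrW_union_of_pointwise_mul3 p hD fun _ _ hS₁ hS₂ => ind_face_gc_ab hsep ha hy hc hac hyc hS₁ hS₂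
  have f14 : PrW (D₁ ∪ D₂) p ((sep (K₁ ∪ K₂) b c ∩ (sep (K₁ ∪ K₂) a c ∩ sep (K₁ ∪ K₂) c y)) ∩ sep (K₁ ∪ K₂) a b) =
      PrW D₁ p (sep K₁ a b) * PrW D₂ p (sep K₂ b c) :=
    PrW_union_of_pointwise_mul p hD fun _ _ hS₁ hS₂ => ind_face_bc_gc_ab hsep ha hy hc hac hyc hbc hS₁ hS₂
  simp only [l1W, massesW, HybMasses.L1, HybMasses.E3h]
  rw [f1, f2, f3, f4, f5, f6, f7, f8, f9, f10, f11, f12, f13, f14, hz, hmb, hm3, he1]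
  ring

end Face

end CubicFourPointL1

end Summit.CriticalPhenomena.PercolationContinuityZ3.Theorems
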